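import Mathlib
import Summits.HodgeConjecture.FermatCycles.HodgeFermatTheoremLRowsB

/-!
# The row p = 3 of THEOREM L, step 1: fibre-constancy in "middle third" form (`HodgeFermat/ThreeFibre.lean`; HF-G30b)

Tree copy (whole module) of the module `HodgeFermat/ThreeFibre.lean` of the sibling cell's standalone package
`run/shared/lean/pub/pub-hodgefermat/lean/HodgeFermat/` (105 lines, sha256 `b5b3eb873118521f…`), source lines 17–105 (all: `Mid`, `triple_res`, fibre-constancy in middle-third form `mid_iff`).
Filed by cell `pub-hfermat`, seat prover-1 gen-3, on the COORDINATOR KEEPER RULING of 2026-08-25 (gem sweep H1: take the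
off-gate kernel theorem `thmFstar` through the gate) — here THEOREM F* of `tables/DPRIME-THEOREM.md` §9 IN FULL, i.e.
PROPOSITION D′(3N) and the descent (`HodgeFermat/PropDPrimeNFinal.lean`, GATE HF-G34), the last off-gate form of THEOREM F*
(its first two forms, `DecodingFinal.thmFstar` = F* at the prime levels and `ThmFstarNFinal.thmFstar` = F*(3N), landed on
2026-08-25 as `HodgeFermatThmFstar.lean` / `HodgeFermatThmFstarN.lean`, seats prover-1 gen-0 / gen-2); this file is one link of
the import closure of `PropDPrimeNFinal.propDprime` (the sibling's KR-free chain: THEOREM L, COROLLARY M, THEOREM D6,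
THEOREM U⁺, THEOREM KR6, THEOREM Z3U) on top of those landed chains.  The source module is the sibling's hub-checked module of
record (pub-hodgefermat `CERT.md` l.960, GATE HF-G30b); its declarations are copied VERBATIM.
Deviations from the source module, exhaustively: the `import` lines (tree modules `Summits.HodgeConjecture.FermatCycles.
HodgeFermat*` instead of `HodgeFermat.*`); this module docstring; none besides these.
Every other line — in particular every declaration's statement and proof — is byte-identical to the source.
HONEST FRAMING: explicit algebraic cycles for specific Hodge classes on Fermat/Delsarte varieties; residual open instances
listed; no claim on general Hodge.  (This file is arithmetic of CM types / finite combinatorics / analytic number theory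
of the sibling's KR-free programme; it claims nothing about cycles.)

The source module's docstring (ThreeFibre.lean l.3–15), verbatim:

## KR-FREE PROGRAMME — the row p = 3 of THEOREM L, step 1: fibre-constancy in "middle third" form

Level `m = 3n` (`3 ∤ n`).  A Z1-at-3 triple `T' = (3y, x₂, x₃)` (`3 ∤ x₂x₃`, `3n ∣ 3y + x₂ + x₃`) that has the CM
type of a Z3-at-3 triple `T = (3a, 3b, 3c)` satisfies, for every unit `t̄` of `ℤ/n`,
  `⟨t x₂⟩_n ∈ M_n ⟺ ⟨t x₃⟩_n ∈ M_n`,  `M_n = {s : n < 3s < 2n}` (the middle third)   [`mid_iff`].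
Proof: LEMMA N (`lemmaN_Z1` at `p = 3`, lifts of `t̄₀ = 3t̄`) and `N_T(t̄₀) ∈ {0, 2}` (`fibreCount_Z3`,
`fibreCount_congr`) give `N = m₂ + m₃ + 2 − 2c₁` with `mᵢ = ⌊3⟨t xᵢ⟩_n / n⌋ ∈ {0, 1, 2}`, so `m₂ + m₃` is even,
i.e. `m₂ = 1 ⟺ m₃ = 1`.

Generation 30 (HF-G30b) of the hodge-fermat build.  LIGHT module (imports `TheoremLRows`).  No `sorry`, no `decide`,
no axiom beyond [propext, Classical.choice, Quot.sound].
-/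

set_option autoImplicit false

namespace HodgeFermat.KRFree.ThreeFibre

open HodgeFermat.KRFree.LemmaN HodgeFermat.KRFree.TheoremL

/-- the middle third `M_n = {s : n < 3s < 2n}` -/
def Mid (n s : ℕ) : Prop := n < 3 * s ∧ 3 * s < 2 * n

/-- `⟨3s⟩_n = 3s − n·⌊3s/n⌋` for the residue `s = ⟨t x⟩_n`, and `⟨(3t) x⟩_n = ⟨3 s⟩_n` -/
lemma triple_res (n t x : ℕ) :
    3 * t * x % n + n * (3 * (t * x % n) / n) = 3 * (t * x % n) := by
  have h := (Nat.mod_modEq (t * x) n).mul_left 3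
  unfold Nat.ModEq at h
  rw [show 3 * (t * x) = 3 * t * x by ring] at h
  have hd := Nat.mod_add_div (3 * (t * x % n)) n
  rw [h] at hd
  exact hd

/-- **Fibre-constancy, middle-third form.**  If the Z1-at-3 triple `(3y, x₂, x₃)` has the CM type of a
Z3-at-3 triple `(3a, 3b, 3c)` at level `3n`, then for every unit `t̄` of `ℤ/n`:
`⟨t x₂⟩_n ∈ M_n ⟺ ⟨t x₃⟩_n ∈ M_n`. -/
theorem mid_iff (n a b c y x₂ x₃ t : ℕ) (h3n : ¬ 3 ∣ n) (hn : 0 < n)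
    (hs : 3 * n ∣ 3 * y + x₂ + x₃) (hx₂ : ¬ 3 ∣ x₂) (hx₃ : ¬ 3 ∣ x₃)
    (hH : SameType (3 * n) (3 * a, 3 * b, 3 * c) (3 * y, x₂, x₃)) (ht : Nat.Coprime t n) :
    Mid n (t * x₂ % n) ↔ Mid n (t * x₃ % n) := by
  have hp : Nat.Prime 3 := Nat.prime_three
  have h3co : Nat.Coprime 3 n := (Nat.Prime.coprime_iff_not_dvd hp).mpr h3n
  have ht₀ : Nat.Coprime (3 * t) n := Nat.Coprime.mul_left h3co ht
  have ht₁ : 3 * t ≡ 3 * t [MOD n] := Nat.ModEq.refl _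
  have hF := fibreCount_Z3 3 n a b c (3 * t) hp h3n ht₀
  rw [fibreCount_congr hH] at hF
  have hN := lemmaN_Z1 3 n y x₂ x₃ (3 * t) t hp h3n hn hs hx₂ hx₃ ht₀ ht₁
  have hR₁d : n ∣ rsum n (3 * y, x₂, x₃) t := rsum_dvd t (dvd_of_level hs)
  have e₀ : rsum n (3 * y, x₂, x₃) (3 * t)
      = 3 * t * (3 * y) % n + 3 * t * x₂ % n + 3 * t * x₃ % n := rfl
  have e₁ : rsum n (3 * y, x₂, x₃) t = t * (3 * y) % n + t * x₂ % n + t * x₃ % n := rfl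
  have ey : 3 * t * y % n = t * (3 * y) % n := by rw [show 3 * t * y = t * (3 * y) by ring]
  rw [ey, e₀] at hN
  rw [e₁] at hN hR₁d
  have hA := triple_res n t (3 * y)
  have hB := triple_res n t x₂
  have hC := triple_res n t x₃
  -- opaque names
  obtain ⟨ρ, hρ⟩ : ∃ s, t * (3 * y) % n = s := ⟨_, rfl⟩
  obtain ⟨s₂, hs₂⟩ : ∃ s, t * x₂ % n = s := ⟨_, rfl⟩
  obtain ⟨s₃, hs₃⟩ : ∃ s, t * x₃ % n = s := ⟨_, rfl⟩
  have hρn : ρ < n := by rw [← hρ]; exact Nat.mod_lt _ hn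
  have hs₂n : s₂ < n := by rw [← hs₂]; exact Nat.mod_lt _ hn
  have hs₃n : s₃ < n := by rw [← hs₃]; exact Nat.mod_lt _ hn
  rw [hρ] at hN hA
  rw [hs₂] at hN hB
  rw [hs₃] at hN hC
  rw [hρ, hs₂, hs₃] at hR₁d
  obtain ⟨A, hAe⟩ : ∃ s, 3 * t * (3 * y) % n = s := ⟨_, rfl⟩
  obtain ⟨B, hBe⟩ : ∃ s, 3 * t * x₂ % n = s := ⟨_, rfl⟩
  obtain ⟨C, hCe⟩ : ∃ s, 3 * t * x₃ % n = s := ⟨_, rfl⟩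
  rw [hAe, hBe, hCe] at hN
  rw [hAe] at hA
  rw [hBe] at hB
  rw [hCe] at hC
  obtain ⟨k₁, hk₁⟩ : ∃ k, 3 * ρ / n = k := ⟨_, rfl⟩
  obtain ⟨m₂, hm₂⟩ : ∃ k, 3 * s₂ / n = k := ⟨_, rfl⟩
  obtain ⟨m₃, hm₃⟩ : ∃ k, 3 * s₃ / n = k := ⟨_, rfl⟩
  have hm₂3 : m₂ < 3 := by rw [← hm₂]; exact (Nat.div_lt_iff_lt_mul hn).mpr (by omega)
  have hm₃3 : m₃ < 3 := by rw [← hm₃]; exact (Nat.div_lt_iff_lt_mul hn).mpr (by omega)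
  rw [hk₁] at hN hA
  rw [hm₂] at hB
  rw [hm₃] at hC
  obtain ⟨F, hFe⟩ : ∃ k, fibreCount 3 n (3 * y, x₂, x₃) (3 * t) = k := ⟨_, rfl⟩
  rw [hFe] at hF hN
  obtain ⟨c₁, hc₁⟩ := hR₁d
  rw [hc₁] at hN
  -- the key count: F + 2c₁ + 1 = 3 + m₂ + m₃
  have key : n * (F + 2 * c₁ + 1) = n * (3 + m₂ + m₃) := by
    zify at hN hA hB hC hc₁ ⊢
    linear_combination hN - hA - hB - hC - 3 * hc₁
  have key' := Nat.eq_of_mul_eq_mul_left hn key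
  have hpar : m₂ = 1 ↔ m₃ = 1 := by
    rcases hF with h0 | h0 <;> simp only [h0] at key' <;> omega
  -- `s ∈ M_n ⟺ ⌊3s/n⌋ = 1` (using `3 ∤ n`)
  have hB' : n * m₂ ≤ 3 * s₂ ∧ 3 * s₂ < n * m₂ + n := by
    have := Nat.mod_lt (3 * t * x₂) hn; rw [hBe] at this; omega
  have hC' : n * m₃ ≤ 3 * s₃ ∧ 3 * s₃ < n * m₃ + n := by
    have := Nat.mod_lt (3 * t * x₃) hn; rw [hCe] at this; omega
  unfold Mid
  interval_cases m₂ <;> interval_cases m₃ <;> simp at hpar <;> omega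

end HodgeFermat.KRFree.ThreeFibre
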